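import Summits.CriticalPhenomena.PercolationContinuityZ3.Theorems.PercNearOneGluingNoHeavyLowerTailAntitheticHandleDualShift
import Summits.CriticalPhenomena.PercolationContinuityZ3.Theorems.PercNearOneGluingNoHeavyLowerTailAntitheticTransportShift
import Summits.CriticalPhenomena.PercolationContinuityZ3.Theorems.PercNearOneGluingNoHeavyLowerTailAntitheticFan4Shift
import HarnessLib

/-!
# `NoHeavyLowerTail` (stmt-CriticalPhenomena-4575) — antithetic cluster pairs: **THEOREM F4H — THE 4-FAN (`K_{1,1,4}`) PLUS A HANDLE FROM ITS
# HUB** (the vertex antithetic inequality at `R = {x}` / CONJECTURE Δ2, ALL arm lengths, handle end ANY vertex; prim-hp-2 gen 67,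
# HOME/MEMO-gen67.md §1)

Support file (`--supports stmt-CriticalPhenomena-4575`, hull-port prover `prim-hp-2`, gen 67).  No definitions, no named facts, no sorries;
COMPUTATIONAL only through its input …AntitheticFan4Shift (kernel decisions by `native_decide`) and one `decide` over `Fin 6` here.

WHY THIS CORE.  The 4-fan from its hub (`s` and `h` joined to each other and to four leaves; target `h`) is the smallest gadget that is
odd-⊕ exactly but has NO red-dominated cube certificate of dimension ≤ 4 (kit j283454, HOME/MEMO-gen65.md §3(b)) and whose super-odd ⊕-status
is undecided — none of the programme's currencies (boxes, pair-cube certificates, comparability, apex lemmas at `P`) certifies `(fan4, s, h)`.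
Its `𝒮_shift` statements are decided in the kernel (…AntitheticFan4Shift), and the `𝒮_shift` dual handle theorem
(…AntitheticHandleDualShift) turns them into:
* `Antithetic.Fan4.swap_invariant` (leaves exchangeable); inside the main proof the two core hypotheses are put in colouring form on any `V`
  (transport along `c`, …AntitheticTransportShift; target `Q = c q` arbitrary: `q = 0` empty event, `q = 1` the hub, `q ≥ 2` a leaf by
  symmetry) — inlined, since as separate theorems their conclusions coincide syntactically with …K24Handle's (`dedup` lint);
* `Antithetic.Fan4.handle_vertex_sum_nonneg` — **THEOREM F4H**: the 4-fan on `c 0 = s`, `c 1 = h`, leaves `c 2, …, c 5`, a handle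
  `c 1 = u 0 – … – u a = y – x – z = w b – … – w 0 = c q` (any `q : Fin 6`, fresh arm vertices, `a, b ≥ 0`, `x` fresh, `yz ∉ H`): for all
  monotone `F, G`, `0 ≤ Σ_{ω : ¬(x ∈ X_E ω ∧ x ∈ Y_E ω)} (F(X_E ω) − F(Y_E ω))·(G(X_E ω) − G(Y_E ω))`, `E = fan4 ∪ arms + xy + xz`
  (edge set of `H` bracketed `stub ∪ (E₀ ∪ arm)`).
[cite: VandenbergHaggstromKahn2005, §1 p. 6 ("Harris' inequality"), §1 p. 3 (open cluster `C_s`)]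
-/

noncomputable section

namespace Summit.CriticalPhenomena.PercolationContinuityZ3.Theorems

open Literature.Probability.Percolation
open scoped Classical

namespace Antithetic

namespace Fan4

variable {V : Type*} {c : Fin 6 → V} (hc : Function.Injective c) {E₀ : Set (Sym2 V)}
  (hE₀ : E₀ = Sym2.map c '' ↑({s(0, 1), s(0, 2), s(0, 3), s(0, 4), s(0, 5), s(1, 2), s(1, 3), s(1, 4), s(1, 5)} : Finset (Sym2 (Fin 6))))
include hc hE₀

omit hc hE₀ in
/-- The leaves of the 4-fan are exchangeable: `E₁` is invariant under the transposition of the leaf `2` with any `q ∉ {0, 1}`.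
[this work] -/
theorem swap_invariant : ∀ q : Fin 6, q ≠ 0 → q ≠ 1 →
    ({s(0, 1), s(0, 2), s(0, 3), s(0, 4), s(0, 5), s(1, 2), s(1, 3), s(1, 4), s(1, 5)} : Finset (Sym2 (Fin 6))).image
        (Sym2.map (Equiv.swap (2 : Fin 6) q)) =
      ({s(0, 1), s(0, 2), s(0, 3), s(0, 4), s(0, 5), s(1, 2), s(1, 3), s(1, 4), s(1, 5)} : Finset (Sym2 (Fin 6))) := by
  decide

variable [Fintype V] {q : Fin 6} {u w : ℕ → V} {a b : ℕ}
  (hu0 : u 0 = c 1) (hw0 : w 0 = c q)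
  (hufresh : ∀ i, 0 < i → i ≤ a → ∀ f ∈ E₀ ∪ Cyc.edgeSet b w, u i ∈ f → f.IsDiag)
  (hwfresh : ∀ i, 0 < i → i ≤ b → ∀ f ∈ E₀, w i ∈ f → f.IsDiag)
  (huinj : ∀ i j, i ≤ a → j ≤ a → u i = u j → i = j) (hwinj : ∀ i j, i ≤ b → j ≤ b → w i = w j → i = j)
  (hsu : ∀ i, 0 < i → i ≤ a → c 0 ≠ u i) (hsw : ∀ i, 0 < i → i ≤ b → c 0 ≠ w i)
  (hPw : ∀ i, 0 < i → i ≤ b → c 1 ≠ w i) (hzu : ∀ i, 0 < i → i ≤ a → w b ≠ u i)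
include hu0 hw0 hufresh hwfresh huinj hwinj hsu hsw hPw hzu

/-- **THEOREM F4H (4-fan + handle from the hub, all arm lengths).**  The 4-fan on `c 0 = s`, `c 1 = h` (the target hub) and the
leaves `c 2, …, c 5` (`c` injective, image edge set `E₀`), a handle from `P = c 1` to `Q = c q` (ANY `q : Fin 6`; arms `u 0 = c 1, …, u a = y`
and `w 0 = c q, …, w b = z` of fresh vertices, `a, b ≥ 0`), `x` fresh joined to `y, z`, `yz ∉ H = E₀ ∪ arms`, `E = H + xy + xz`.  Then for
all monotone `F, G`: `0 ≤ Σ_{ω : ¬(x ∈ X_E ω ∧ x ∈ Y_E ω)} (F(X_E ω) − F(Y_E ω))·(G(X_E ω) − G(Y_E ω))`. [this work] -/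
theorem handle_vertex_sum_nonneg {x : V}
    (hx : ∀ f ∈ Cyc.edgeSet b w ∪ (E₀ ∪ Cyc.edgeSet a u), x ∈ f → f.IsDiag)
    (hxs : x ≠ c 0) (hxy : x ≠ u a) (hxz : x ≠ w b) (hyz : u a ≠ w b) (hg : s(u a, w b) ∉ Cyc.edgeSet b w ∪ (E₀ ∪ Cyc.edgeSet a u))
    {F G : Set V → ℝ} (hF : Monotone F) (hG : Monotone G) :
    0 ≤ ∑ ω ∈ Finset.univ.filter (fun ω : Set (Sym2 V) =>
        ¬ ((openGraph (ω ∩ insert s(x, u a) (insert s(x, w b) (Cyc.edgeSet b w ∪ (E₀ ∪ Cyc.edgeSet a u))))).Reachable (c 0) x ∧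
          (openGraph (ωᶜ ∩ insert s(x, u a) (insert s(x, w b) (Cyc.edgeSet b w ∪ (E₀ ∪ Cyc.edgeSet a u))))).Reachable (c 0) x)),
      (F (openCluster (ω ∩ insert s(x, u a) (insert s(x, w b) (Cyc.edgeSet b w ∪ (E₀ ∪ Cyc.edgeSet a u)))) (c 0)) -
          F (openCluster (ωᶜ ∩ insert s(x, u a) (insert s(x, w b) (Cyc.edgeSet b w ∪ (E₀ ∪ Cyc.edgeSet a u)))) (c 0))) *
        (G (openCluster (ω ∩ insert s(x, u a) (insert s(x, w b) (Cyc.edgeSet b w ∪ (E₀ ∪ Cyc.edgeSet a u)))) (c 0)) -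
          G (openCluster (ωᶜ ∩ insert s(x, u a) (insert s(x, w b) (Cyc.edgeSet b w ∪ (E₀ ∪ Cyc.edgeSet a u)))) (c 0))) := by
  -- (the edge set of `H` is written `stub ∪ (E₀ ∪ arm)`; the shifted dual handle theorem writes `stub ∪ (arm ∪ E₀)`)
  have hcomm : Cyc.edgeSet b w ∪ (E₀ ∪ Cyc.edgeSet a u) = Cyc.edgeSet b w ∪ (Cyc.edgeSet a u ∪ E₀) := by rw [Set.union_comm E₀]
  rw [hcomm] at hx hg ⊢
  -- no loops in the image edge set
  have hK : ∀ e ∈ ({s(0, 1), s(0, 2), s(0, 3), s(0, 4), s(0, 5), s(1, 2), s(1, 3), s(1, 4), s(1, 5)} : Finset (Sym2 (Fin 6))), ¬ e.IsDiag := by decide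
  have hnd : ∀ f ∈ E₀, ¬ f.IsDiag := by
    intro f hf
    rw [hE₀] at hf
    obtain ⟨e, he, rfl⟩ := hf
    have hne := hK e (Finset.mem_coe.1 he)
    induction e using Sym2.ind with
    | h i j =>
      rw [Sym2.map_mk, Sym2.mk_isDiag_iff]
      rw [Sym2.mk_isDiag_iff] at hne
      exact fun h => hne (hc h)
  -- (⊕)_shift of `(fan4, s, hub)` in colouring form: the kernel decision, transported along `c`
  have hop : ∀ Fp Fm Gp Gm : Set V → ℝ, Monotone Fp → Monotone Fm → (∀ S, Fm S ≤ Fp S) →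
      Monotone Gp → Monotone Gm → (∀ S, Gm S ≤ Gp S) →
      0 ≤ ∑ T ∈ Finset.univ.filter (fun T : Set (Sym2 V) => c 1 ∈ openCluster (T ∩ E₀) (c 0)),
        (Fp (openCluster (T ∩ E₀) (c 0)) - Fm (openCluster (Tᶜ ∩ E₀) (c 0))) *
          (Gp (openCluster (T ∩ E₀) (c 0)) - Gm (openCluster (Tᶜ ∩ E₀) (c 0))) :=
    fun Fp Fm Gp Gm hFp hFm hF' hGp hGm hG' =>
      TransportShift.oplus_of_powerset hc _ 0 1
        (fun Lp Lm Mp Mm hLp hLm hL hMp hMm hM => by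
          convert oplus_shift_powerset Lp Lm Mp Mm hLp hLm hL hMp hMm hM using 10)
        hE₀ Fp Fm Gp Gm hFp hFm hF' hGp hGm hG'
  -- (M)_shift of `(fan4; hub, c q)` in colouring form: `q = 0` empty event, `q = 1` the hub statement, `q ≥ 2` the leaf statement
  -- transported along `c ∘ (2 q)` (the leaves are exchangeable)
  have hmix : ∀ Fp Fm Gp Gm : Set V → ℝ, Monotone Fp → Monotone Fm → (∀ S, Fm S ≤ Fp S) →
      Monotone Gp → Monotone Gm → (∀ S, Gm S ≤ Gp S) →
      0 ≤ ∑ T ∈ Finset.univ.filter (fun T : Set (Sym2 V) =>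
          c 1 ∈ openCluster (T ∩ E₀) (c 0) ∧ c q ∉ openCluster (Tᶜ ∩ E₀) (c 0)),
        (Fp (openCluster (T ∩ E₀) (c 0)) - Fm (openCluster (Tᶜ ∩ E₀) (c 0))) *
          (Gp (openCluster (T ∩ E₀) (c 0)) - Gm (openCluster (Tᶜ ∩ E₀) (c 0))) := by
    intro Fp Fm Gp Gm hFp hFm hF' hGp hGm hG'
    by_cases hq0 : q = 0
    · refine Finset.sum_nonneg fun T hT => ?_
      rw [hq0] at hT
      exact absurd (mem_openCluster_self _ _) (Finset.mem_filter.1 hT).2.2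
    by_cases hq1 : q = 1
    · rw [hq1]
      exact TransportShift.mixed_of_powerset hc _ 0 1 1
        (fun Lp Lm Mp Mm hLp hLm hL hMp hMm hM => by
          convert mixed_shift_hub_powerset Lp Lm Mp Mm hLp hLm hL hMp hMm hM using 10)
        hE₀ Fp Fm Gp Gm hFp hFm hF' hGp hGm hG'
    set σ : Equiv.Perm (Fin 6) := Equiv.swap (2 : Fin 6) q with hσ
    have hσ0 : σ 0 = 0 := Equiv.swap_apply_of_ne_of_ne (by decide) (Ne.symm hq0)
    have hσ1 : σ 1 = 1 := Equiv.swap_apply_of_ne_of_ne (by decide) (Ne.symm hq1)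
    have hσ2 : σ 2 = q := Equiv.swap_apply_left _ _
    have hc' : Function.Injective (c ∘ σ) := hc.comp σ.injective
    have hE₀' : E₀ = Sym2.map (c ∘ σ) '' ↑({s(0, 1), s(0, 2), s(0, 3), s(0, 4), s(0, 5), s(1, 2), s(1, 3), s(1, 4), s(1, 5)} : Finset (Sym2 (Fin 6))) := by
      rw [hE₀, Sym2.map_comp, Set.image_comp]
      conv_rhs => rw [← Finset.coe_image, swap_invariant q hq0 hq1]
    have h := TransportShift.mixed_of_powerset hc' _ 0 1 2
      (fun Lp Lm Mp Mm hLp hLm hL hMp hMm hM => by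
        convert mixed_shift_leaf_powerset Lp Lm Mp Mm hLp hLm hL hMp hMm hM using 10)
      hE₀' Fp Fm Gp Gm hFp hFm hF' hGp hGm hG'
    simp only [Function.comp, hσ0, hσ1, hσ2] at h
    exact h
  have h := Pendant.handle_vertex_sum_nonneg_of_oplus_shift hnd hwfresh hwinj hsw hPw hop hu0 hw0 hufresh huinj hsu hzu
    hmix hx hxs hxy hxz hyz hg hF hG
  convert h using 3

end Fan4

end Antithetic

end Summit.CriticalPhenomena.PercolationContinuityZ3.Theorems
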